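import Summits.KontsevichZagierPeriods.KontsevichZagierPeriods.Theorems.MzvKernelInKZTwoPosetsDefs

/-!
# `MzvKernelInKZ` (stmt-KontsevichZagierPeriods-3914), line two-posets-interior-landen:
# EDS certificates in weights `≤ 6`

Stub `stub_edsCertificateLow : ∀ N ≤ 6, EdsCertificate N` of the lead's skeleton: every
admissible word of weight `N ≤ 6` is, as a coefficient vector, an explicit rational combination
of Hoffman words modulo finite-double-shuffle vectors `fdsVec`, Hoffman-relation vectors
`hoffmanVec` and duality vectors `dualVec` (vocabulary of `MzvKernelInKZTwoPosetsDefs`).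

Method (proof by reflection, kernel-checked, no `native_decide`):
* a certificate (`Cert`) lists the word (as an index), the Hoffman coefficients `H` and the
  relation coefficients `F`, `D`, `K`; `Cert.fvec` expands `e_ε − Σ_H − (Σ_F + Σ_D + Σ_K)` into a
  formal `ℚ`-combination of words-as-lists (`FVec`), computing `MZV.shuffleWord`, `MZV.stuffle`,
  `MZV.binaryWord` and the Hoffman/duality indexings literally as in the definitions;
* `FVec.eval_eq_zero`: if every word has total coefficient `0` (`FVec.isZero`, a Boolean test)
  the realised vector in `Vec N` vanishes (the realisation factors through the free module,
  `Finsupp.linearCombination`); `Cert.eval_fvec` identifies the realisation of `Cert.fvec` with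
  the two sides of the certificate identity (`eval_fdsF`, `eval_hoffmanF`, `eval_dualF`);
* per weight, the table of certificates is checked by ONE `decide` (side conditions and
  `isZero`), and the covering of all admissible words by the table by another `decide`.
The certificates were found by exact linear algebra over `ℚ` (row reduction of the relation
family against the `2^{N-2}` admissible words; codimension `d_N` = number of Hoffman words, as
predicted by Zagier's conjecture and Ihara–Kaneko–Zagier's Conjecture 1), e.g.
`ζ(4) = 4/3 ζ(2,2)`, `ζ(5) = 6/5 ζ(2,3) + 4/5 ζ(3,2)`, `ζ(6) = 16/3 ζ(2,2,2)`.

Sources: K. Ihara, M. Kaneko, D. Zagier, *Derivation and double shuffle relations for multiple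
zeta values*, Compos. Math. 142 (2006), §1–§2 (finite/extended double shuffle, the tables in low
weight); M. E. Hoffman, *Multiple harmonic series*, Pacific J. Math. 152 (1992), Thm 5.1;
D. Zagier, *Values of zeta functions and their applications* (1994), §9 (duality).
-/

namespace Summit.KontsevichZagierPeriods.MzvKernelInKZ.TwoPosets

open Literature.NumberTheory.Transcendental
open Summit.KontsevichZagierPeriods.MzvKernelInKZ.Negative

/-! ## Formal combinations of words and their realisation -/

/-- Formal `ℚ`-linear combinations of words written as lists of letters (with repetitions).
[folklore] -/
abbrev FVec : Type := List (List Bool × ℚ)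

namespace FVec

/-- Realisation of a formal combination as a coefficient vector on the words of length `N`.
[folklore] -/
def eval (N : ℕ) (v : FVec) : Vec N := (v.map fun p => p.2 • unitVec N (wordOf N p.1)).sum

/-- Total coefficient of the word `L` in a formal combination. [folklore] -/
def coeff (v : FVec) (L : List Bool) : ℚ := (v.map fun p => if p.1 = L then p.2 else 0).sum

/-- Boolean test: every word occurring in `v` has total coefficient `0`. [folklore] -/
def isZero (v : FVec) : Bool := v.all fun p => decide (coeff v p.1 = 0)

/-- Scalar multiple of a formal combination. [folklore] -/
def smul (q : ℚ) (v : FVec) : FVec := v.map fun p => (p.1, q * p.2)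

/-- The formal sum of a list of words, all with the same coefficient `q`. [folklore] -/
def ofWords (L : List (List Bool)) (q : ℚ) : FVec := L.map fun w => (w, q)

/-- Realisation of the empty combination. [folklore] -/
@[simp] theorem eval_nil (N : ℕ) : eval N [] = 0 := by simp [eval]

/-- Realisation of a combination with a leading term. [folklore] -/
@[simp] theorem eval_cons (N : ℕ) (p : List Bool × ℚ) (v : FVec) :
    eval N (p :: v) = p.2 • unitVec N (wordOf N p.1) + eval N v := by simp [eval]

/-- Realisation is additive under concatenation. [folklore] -/
@[simp] theorem eval_append (N : ℕ) (u v : FVec) : eval N (u ++ v) = eval N u + eval N v := by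
  simp [eval, List.sum_append]

/-- Realisation commutes with scalar multiplication. [folklore] -/
@[simp] theorem eval_smul (N : ℕ) (q : ℚ) (v : FVec) : eval N (smul q v) = q • eval N v := by
  simp [eval, smul, List.smul_sum, List.map_map, Function.comp_def, smul_smul]

/-- Realisation of a general mapped list. [folklore] -/
theorem eval_map {α : Type*} (N : ℕ) (l : List α) (f : α → List Bool × ℚ) :
    eval N (l.map f) = (l.map fun a => (f a).2 • unitVec N (wordOf N (f a).1)).sum := by
  simp [eval, List.map_map, Function.comp_def]

/-- Realisation of a concatenation of combinations indexed by a list. [folklore] -/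
theorem eval_flatMap {α : Type*} (N : ℕ) (l : List α) (g : α → FVec) :
    eval N (l.flatMap g) = (l.map fun a => eval N (g a)).sum := by
  induction l with
  | nil => simp
  | cons a l ih => simp [ih]

/-- Realisation of a list of words with a common coefficient. [folklore] -/
theorem eval_ofWords (N : ℕ) (L : List (List Bool)) (q : ℚ) :
    eval N (ofWords L q) = q • listVec N (L.map (wordOf N)) := by
  induction L with
  | nil => simp [ofWords, listVec]
  | cons w L ih =>
    simp only [ofWords, listVec, List.map_cons, eval_cons, List.sum_cons, smul_add] at ih ⊢
    rw [ih]

/-- The realisation factors through the free module on words-as-lists. [folklore] -/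
theorem eval_eq_linearCombination (N : ℕ) (v : FVec) :
    eval N v = Finsupp.linearCombination ℚ (fun L => unitVec N (wordOf N L))
      ((v.map fun p => Finsupp.single p.1 p.2).sum) := by
  rw [map_list_sum, List.map_map]
  simp [eval, Function.comp_def, Finsupp.linearCombination_single]

/-- The coefficient of `L` in the associated finitely supported function is `coeff v L`.
[folklore] -/
theorem sum_single_apply (v : FVec) (L : List Bool) :
    ((v.map fun p => Finsupp.single p.1 p.2).sum) L = coeff v L := by
  change Finsupp.applyAddHom L _ = _
  rw [map_list_sum, List.map_map]
  simp only [coeff, Function.comp_def, Finsupp.applyAddHom_apply, Finsupp.single_apply]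

/-- A word not occurring in `v` has total coefficient `0`. [folklore] -/
theorem coeff_eq_zero_of_forall_ne (v : FVec) (L : List Bool) (h : ∀ p ∈ v, p.1 ≠ L) :
    coeff v L = 0 := by
  unfold coeff
  apply List.sum_eq_zero
  intro x hx
  obtain ⟨p, hp, rfl⟩ := List.mem_map.1 hx
  simp [h p hp]

/-- **Soundness of the zero test**: if every occurring word has total coefficient `0`, the
realised vector vanishes. [folklore] -/
theorem eval_eq_zero (N : ℕ) {v : FVec} (h : isZero v = true) : eval N v = 0 := by
  have hc : ∀ L, coeff v L = 0 := by
    intro L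
    by_cases hL : ∃ p ∈ v, p.1 = L
    · obtain ⟨p, hp, rfl⟩ := hL
      simpa using (List.all_eq_true.1 h) p hp
    · exact coeff_eq_zero_of_forall_ne v L fun p hp h' => hL ⟨p, hp, h'⟩
  have hs : ((v.map fun p => Finsupp.single p.1 p.2).sum) = 0 := by
    ext L
    rw [sum_single_apply, hc, Finsupp.zero_apply]
  rw [eval_eq_linearCombination, hs, map_zero]

end FVec

/-! ## Formal versions of the relation vectors -/

/-- Formal finite double shuffle vector of the pair `(s, t)`. [folklore] -/
def fdsF (s t : List ℕ) : FVec :=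
  FVec.ofWords (MZV.shuffleWord (MZV.binaryWord s) (MZV.binaryWord t)) 1 ++
    FVec.ofWords ((MZV.stuffle s t).map MZV.binaryWord) (-1)

/-- `fdsF` realises to `fdsVec`. [folklore] -/
theorem eval_fdsF (N : ℕ) (s t : List ℕ) : FVec.eval N (fdsF s t) = fdsVec N s t := by
  simp only [fdsF, FVec.eval_append, FVec.eval_ofWords, fdsVec, List.map_map, one_smul,
    neg_one_smul, sub_eq_add_neg]
  rfl

/-- Formal Hoffman relation vector of the index `s` (indexed as `hoffmanVec`). [folklore] -/
def hoffmanF (s : List ℕ) : FVec :=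
  ((List.finRange s.length).map fun l =>
      (MZV.binaryWord (s.take l.1 ++ [s.get l + 1] ++ s.drop (l.1 + 1)), (1 : ℚ))) ++
    (List.finRange s.length).flatMap fun l => (List.range (s.get l - 1)).map fun j =>
      (MZV.binaryWord (s.take l.1 ++ [s.get l - j, j + 1] ++ s.drop (l.1 + 1)), (-1 : ℚ))

/-- List sums over `List.range` are `Finset.range` sums. [folklore] -/
theorem sum_range_map {N : ℕ} (f : ℕ → Vec N) (m : ℕ) :
    ((List.range m).map f).sum = ∑ j ∈ Finset.range m, f j := by
  induction m with
  | zero => simp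
  | succ m ih => rw [List.sum_range_succ, Finset.sum_range_succ, ih]

/-- `hoffmanF` realises to `hoffmanVec`. [folklore] -/
theorem eval_hoffmanF (N : ℕ) (s : List ℕ) : FVec.eval N (hoffmanF s) = hoffmanVec N s := by
  simp only [hoffmanF, FVec.eval_append, FVec.eval_flatMap, FVec.eval_map, ← Fin.sum_univ_def,
    sum_range_map, one_smul, neg_one_smul, Finset.sum_neg_distrib, hoffmanVec, sub_eq_add_neg]
  rfl

/-- Reading back a word written out as a list. [folklore] -/
theorem wordOf_ofFn (N : ℕ) (g : Fin N → Bool) : wordOf N (List.ofFn g) = g := by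
  funext i
  simp [wordOf, List.getD_eq_getElem?_getD, i.isLt]

/-- Formal duality vector of a word-as-list, read in length `N`. [folklore] -/
def dualF (N : ℕ) (L : List Bool) : FVec := [(L, 1), (List.ofFn (dualWord (wordOf N L)), -1)]

/-- `dualF` realises to `dualVec`. [folklore] -/
theorem eval_dualF (N : ℕ) (L : List Bool) : FVec.eval N (dualF N L) = dualVec N (wordOf N L) := by
  simp only [dualF, FVec.eval_cons, FVec.eval_nil, wordOf_ofFn, one_smul, neg_one_smul, add_zero,
    dualVec, sub_eq_add_neg]

/-! ## Certificates and the checker -/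

/-- A certificate for one admissible word: the word as an index `w`, Hoffman coefficients `H`,
finite-double-shuffle coefficients `F`, Hoffman-relation coefficients `D`, duality coefficients
`K` (words as indices). [folklore] -/
structure Cert where
  /-- the word, as an index -/
  w : List ℕ
  /-- Hoffman indices of weight `N` with coefficients -/
  H : List (List ℕ × ℚ)
  /-- pairs of non-empty admissible indices of total weight `N` with coefficients -/
  F : List ((List ℕ × List ℕ) × ℚ)
  /-- admissible indices of weight `N - 1` with coefficients -/
  D : List (List ℕ × ℚ)
  /-- admissible words (as indices) with coefficients -/
  K : List (List ℕ × ℚ)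

namespace Cert

/-- The formal expansion of `e_w − Σ_H − (Σ_F + Σ_D + Σ_K)` of a certificate. [folklore] -/
def fvec (N : ℕ) (c : Cert) : FVec :=
  (MZV.binaryWord c.w, 1) :: (c.H.map fun p => (MZV.binaryWord p.1, -p.2)) ++
    FVec.smul (-1) (c.F.flatMap (fun p => FVec.smul p.2 (fdsF p.1.1 p.1.2)) ++
      c.D.flatMap (fun p => FVec.smul p.2 (hoffmanF p.1)) ++
      c.K.flatMap (fun p => FVec.smul p.2 (dualF N (MZV.binaryWord p.1))))

/-- The checker: the four side conditions of `EdsCertificate` on the data of a certificate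
(decidable predicates, read as Booleans) and the vanishing of the formal expansion. [folklore] -/
def ok (N : ℕ) (c : Cert) : Bool :=
  decide (∀ p ∈ c.H, MZV.IsHoffman p.1 ∧ MZV.weight p.1 = N) &&
  decide (∀ p ∈ c.F, MZV.IsAdmissible p.1.1 ∧ MZV.IsAdmissible p.1.2 ∧ p.1.1 ≠ [] ∧ p.1.2 ≠ [] ∧
    MZV.weight p.1.1 + MZV.weight p.1.2 = N) &&
  decide (∀ p ∈ c.D, MZV.IsAdmissible p.1 ∧ MZV.weight p.1 + 1 = N) &&
  decide (∀ p ∈ c.K, Adm (bword N p.1)) && (c.fvec N).isZero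

/-- Negating every term of a list sum. [folklore] -/
theorem sum_map_neg {α : Type*} {N : ℕ} (l : List α) (f : α → Vec N) :
    (l.map fun a => -f a).sum = -(l.map f).sum := by
  induction l with
  | nil => simp
  | cons a l ih => simp [ih, add_comm]

/-- The formal expansion realises to the difference of the two sides of the certificate
identity. [folklore] -/
theorem eval_fvec (N : ℕ) (c : Cert) : FVec.eval N (c.fvec N) =
    (unitVec N (bword N c.w) - (c.H.map fun p => p.2 • unitVec N (bword N p.1)).sum) -
      ((c.F.map fun p => p.2 • fdsVec N p.1.1 p.1.2).sum +
        (c.D.map fun p => p.2 • hoffmanVec N p.1).sum +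
        (c.K.map fun p => p.2 • dualVec N (bword N p.1)).sum) := by
  simp only [fvec, FVec.eval_cons, FVec.eval_append, FVec.eval_smul, FVec.eval_flatMap,
    FVec.eval_map, eval_fdsF, eval_hoffmanF, eval_dualF, neg_smul, sum_map_neg, one_smul, bword]
  abel

/-- **Soundness of the checker**: an accepted certificate proves the `EdsCertificate` clause of
its word. [folklore] -/
theorem sound (N : ℕ) (c : Cert) (h : c.ok N = true) :
    ∃ (H : List (List ℕ × ℚ)) (F : List ((List ℕ × List ℕ) × ℚ)) (D : List (List ℕ × ℚ))
      (K : List ((Fin N → Bool) × ℚ)),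
      (∀ p ∈ H, MZV.IsHoffman p.1 ∧ MZV.weight p.1 = N) ∧
      (∀ p ∈ F, MZV.IsAdmissible p.1.1 ∧ MZV.IsAdmissible p.1.2 ∧ p.1.1 ≠ [] ∧ p.1.2 ≠ [] ∧
        MZV.weight p.1.1 + MZV.weight p.1.2 = N) ∧
      (∀ p ∈ D, MZV.IsAdmissible p.1 ∧ MZV.weight p.1 + 1 = N) ∧
      (∀ p ∈ K, Adm p.1) ∧
      unitVec N (bword N c.w) - (H.map fun p => p.2 • unitVec N (bword N p.1)).sum =
        (F.map fun p => p.2 • fdsVec N p.1.1 p.1.2).sum +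
          (D.map fun p => p.2 • hoffmanVec N p.1).sum +
          (K.map fun p => p.2 • dualVec N p.1).sum := by
  simp only [ok, Bool.and_eq_true, decide_eq_true_eq] at h
  obtain ⟨⟨⟨⟨hH, hF⟩, hD⟩, hK⟩, hz⟩ := h
  refine ⟨c.H, c.F, c.D, c.K.map fun p => (bword N p.1, p.2), hH, hF, hD, ?_, ?_⟩
  · intro p hp
    obtain ⟨q, hq, rfl⟩ := List.mem_map.1 hp
    exact hK q hq
  · have h0 := FVec.eval_eq_zero N hz
    rw [eval_fvec, sub_eq_zero] at h0
    rw [h0, List.map_map]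
    rfl

end Cert

/-- **From a checked table to `EdsCertificate N`**: if every certificate of the table passes the
checker and every admissible word of length `N` is the word of some certificate of the table,
then `EdsCertificate N` holds. [folklore] -/
theorem edsCertificate_of_table (N : ℕ) (T : List Cert) (hT : T.all (Cert.ok N) = true)
    (hcover : ∀ ε : Fin N → Bool, Adm ε → ∃ c ∈ T, bword N c.w = ε) : EdsCertificate N := by
  intro ε hε
  obtain ⟨c, hc, rfl⟩ := hcover ε hε
  exact Cert.sound N c (List.all_eq_true.1 hT c hc)

/-! ## The tables (found by exact linear algebra over `ℚ`, fewest generators first; checked below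
by the kernel) -/

/-- The certificate tables, weight by weight. Weight `0`: the empty word is the empty Hoffman
index; weight `1`: no admissible word; weights `2`, `3`: `ζ(2)`, `ζ(3)` are Hoffman and
`ζ(2,1) = ζ(3)` is duality; weight `4`: `ζ(4) = 4/3 ζ(2,2)`, `ζ(3,1) = 1/3 ζ(2,2)`,
`ζ(2,1,1) = 4/3 ζ(2,2)`; weights `5`, `6`: `d₅ = d₆ = 2` with Hoffman words `ζ(2,3), ζ(3,2)` and
`ζ(2,2,2), ζ(3,3)`. -/
def table : ℕ → List Cert
  | 0 => [⟨[], [([], 1)], [], [], []⟩]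
  | 2 => [⟨[2], [([2], 1)], [], [], []⟩]
  | 3 => [⟨[3], [([3], 1)], [], [], []⟩, ⟨[2, 1], [([3], 1)], [], [], [([3], -1)]⟩]
  | 4 => [⟨[4], [([2, 2], 4/3)], [(([2], [2]), 1/3)], [([3], 4/3)], []⟩,
      ⟨[3, 1], [([2, 2], 1/3)], [(([2], [2]), 1/3)], [([3], 1/3)], []⟩,
      ⟨[2, 2], [([2, 2], 1)], [], [], []⟩,
      ⟨[2, 1, 1], [([2, 2], 4/3)], [(([2], [2]), 1/3)], [([2, 1], -1), ([3], 1/3)], []⟩]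
  | 5 => [
    ⟨[5], [([2, 3], 6/5), ([3, 2], 4/5)], [(([2], [3]), 1/5)], [([4], 6/5)], []⟩,
    ⟨[4, 1], [([2, 3], 1/5), ([3, 2], -1/5)], [(([2], [3]), 1/5)], [([4], 1/5)], []⟩,
    ⟨[3, 2], [([3, 2], 1)], [], [], []⟩,
    ⟨[3, 1, 1], [([2, 3], 1/5), ([3, 2], -1/5)], [(([2], [2, 1]), 1/5)], [([3, 1], 1/5)], []⟩,
    ⟨[2, 3], [([2, 3], 1)], [], [], []⟩,
    ⟨[2, 2, 1], [([3, 2], 1)], [], [], [([3, 2], -1)]⟩,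
    ⟨[2, 1, 2], [([2, 3], 1)], [], [], [([2, 3], -1)]⟩,
    ⟨[2, 1, 1, 1], [([2, 3], 6/5), ([3, 2], 4/5)], [(([2], [3]), 1/5)], [([4], 6/5)], [([5], -1)]⟩]
  | 6 => [
    ⟨[6], [([2, 2, 2], 16/3)],
      [(([2], [2, 2]), 4/3), (([2], [3, 1]), 8/3), (([2], [4]), 2/3), (([2, 1], [3]), -8/3),
        (([3], [3]), -1/3)],
      [([3, 2], 8/3), ([5], 4/3)],
      [([3, 1, 2], 8/3)]⟩,
    ⟨[5, 1], [([2, 2, 2], 4/3), ([3, 3], -1)],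
      [(([2], [2, 2]), 1/9), (([2, 1], [2, 1]), 2/9), (([3], [3]), -1/9)],
      [([3, 1, 1], 4/9), ([3, 2], 8/9), ([5], -1/9)],
      [([5, 1], 20/9)]⟩,
    ⟨[4, 2], [([2, 2, 2], -16/9), ([3, 3], 2)],
      [(([2], [2, 2]), -4/9), (([2], [3, 1]), -8/9), (([2], [4]), -11/9), (([2, 1], [3]), 8/9),
        (([3], [3]), 7/9)],
      [([3, 2], -8/9), ([5], -4/9)],
      [([3, 1, 2], -8/9)]⟩,
    ⟨[4, 1, 1], [([2, 2, 2], 7/3), ([3, 3], -2)],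
      [(([2], [2, 2]), -1/6), (([2], [3, 1]), -1/6), (([2, 1], [3]), -1/6), (([3], [3]), 1/3)],
      [([3, 2], 13/6), ([4, 1], -4), ([5], 1/3)],
      [([3, 1, 2], 19/6)]⟩,
    ⟨[3, 3], [([3, 3], 1)], [], [], []⟩,
    ⟨[3, 2, 1], [([2, 2, 2], -59/9), ([3, 3], 6)],
      [(([2], [2, 2]), -1/9), (([2], [3, 1]), 4/9), (([2, 1], [2, 1]), -4/9), (([2, 1], [3]), 1/9)],
      [([3, 1, 1], -16/3), ([3, 2], -50/9), ([4, 1], 5/9)],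
      [([4, 2], 40/9)]⟩,
    ⟨[3, 1, 2], [([2, 2, 2], 34/9), ([3, 3], -3)],
      [(([2], [2, 2]), 1/9), (([2], [4]), 1/9), (([2, 1], [3]), -5/9), (([3], [3]), 1/3)],
      [([3, 2], 29/9), ([4, 1], -5), ([5], 4/9)],
      [([3, 1, 2], 44/9)]⟩,
    ⟨[3, 1, 1, 1], [([2, 2, 2], 4/3), ([3, 3], -1)],
      [(([2], [2, 2]), 1/9), (([2, 1], [2, 1]), 2/9), (([3], [3]), -1/9)],
      [([3, 1, 1], 4/9), ([3, 2], 8/9), ([5], -1/9)],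
      [([5, 1], 11/9)]⟩,
    ⟨[2, 4], [([2, 2, 2], 52/9), ([3, 3], -2)],
      [(([2], [2, 2]), 13/9), (([2], [3, 1]), 26/9), (([2], [4]), 11/9), (([2, 1], [3]), -26/9),
        (([3], [3]), -7/9)],
      [([3, 2], 26/9), ([5], 4/9)],
      [([3, 1, 2], 26/9)]⟩,
    ⟨[2, 3, 1], [([2, 2, 2], 34/9), ([3, 3], -3)],
      [(([2], [2, 2]), 1/9), (([2], [4]), 1/9), (([2, 1], [3]), -5/9), (([3], [3]), 1/3)],
      [([3, 2], 29/9), ([4, 1], -5), ([5], 4/9)],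
      [([3, 1, 2], 35/9)]⟩,
    ⟨[2, 2, 2], [([2, 2, 2], 1)], [], [], []⟩,
    ⟨[2, 2, 1, 1], [([2, 2, 2], -16/9), ([3, 3], 2)],
      [(([2], [2, 2]), -4/9), (([2], [3, 1]), -8/9), (([2], [4]), -11/9), (([2, 1], [3]), 8/9),
        (([3], [3]), 7/9)],
      [([3, 2], -8/9), ([5], -4/9)],
      [([3, 1, 2], -8/9), ([4, 2], -1)]⟩,
    ⟨[2, 1, 3], [([2, 2, 2], 1), ([3, 3], 2)],
      [(([2], [2, 2]), 1/2), (([2], [3, 1]), 3/2), (([2, 1], [3]), -3/2)],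
      [([2, 3], -1), ([3, 2], 1/2)],
      [([3, 1, 2], 3/2)]⟩,
    ⟨[2, 1, 2, 1], [([3, 3], 1)], [], [], [([3, 3], -1)]⟩,
    ⟨[2, 1, 1, 2], [([2, 2, 2], 52/9), ([3, 3], -2)],
      [(([2], [2, 2]), 13/9), (([2], [3, 1]), 26/9), (([2], [4]), 11/9), (([2, 1], [3]), -26/9),
        (([3], [3]), -7/9)],
      [([3, 2], 26/9), ([5], 4/9)],
      [([3, 1, 2], 26/9), ([2, 4], -1)]⟩,
    ⟨[2, 1, 1, 1, 1], [([2, 2, 2], 16/3)],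
      [(([2], [2, 2]), 4/3), (([2], [3, 1]), 8/3), (([2], [4]), 2/3), (([2, 1], [3]), -8/3),
        (([3], [3]), -1/3)],
      [([3, 2], 8/3), ([5], 4/3)],
      [([3, 1, 2], 8/3), ([6], -1)]⟩]
  | _ => []

/-- **EDS certificates in weights `≤ 6`** (stub `stub_edsCertificateLow` of the skeleton of line
two-posets-interior-landen): for every `N ≤ 6`, every admissible word of weight `N` reduces, with
explicit rational coefficients, to Hoffman words modulo finite double shuffle, Hoffman's relation
and duality. Weight by weight, the kernel checks the table (`Cert.ok`) and the covering of the
admissible words by one `decide` each. -/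
theorem stub_edsCertificateLow : ∀ N : ℕ, N ≤ 6 → EdsCertificate N := by
  intro N hN
  interval_cases N
  · exact edsCertificate_of_table 0 (table 0) (by decide +kernel) (by decide +kernel)
  · exact edsCertificate_of_table 1 (table 1) (by decide +kernel) (by decide +kernel)
  · exact edsCertificate_of_table 2 (table 2) (by decide +kernel) (by decide +kernel)
  · exact edsCertificate_of_table 3 (table 3) (by decide +kernel) (by decide +kernel)
  · exact edsCertificate_of_table 4 (table 4) (by decide +kernel) (by decide +kernel)
  · exact edsCertificate_of_table 5 (table 5) (by decide +kernel) (by decide +kernel)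
  · exact edsCertificate_of_table 6 (table 6) (by decide +kernel) (by decide +kernel)

end Summit.KontsevichZagierPeriods.MzvKernelInKZ.TwoPosets
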